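/-
Origin: expansion seat `planner-pub-hodgecm-prl1-0`, handover v4 2026-08-18T03:25:21Z / v5 03:33:51Z (`HOME/pub-hodgecm-prl1/lean/Prl1/CharsOccJoin.lean`, md5 2cdc1fc7, 98 lines);
landed by the gen-5 packager in gate run 18 as `HodgeCM/Automorphic/CharsOccJoin.lean` (import ^import Prl1\.ThetaFacts\b→import HodgeCM.Automorphic.ThetaFacts ×1).
-/
/-
Origin: HOME/pub-hodgecm-prl1/lean/Prl1/CharsOccJoin.lean — session planner-pub-hodgecm-prl1-0 (unit pub-hodgecm-prl1).
Intended final place: `HodgeCM/Automorphic/CharsOccJoin.lean` (imports `HodgeCM.Automorphic.ThetaFacts` only).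
Nothing is asserted: two FINER named inputs (`Prop`s) and the PROVED joins to the facts A9 `Open_chars` and
A10 `Open_occ` of `ThetaModel.Inputs`, through the machine-checked 2001 discharge packages of
`HodgeCM.Prior.Perl34File.Perl34.C4` / `C4a` (vendored, attribution in that file).
-/
import Summits.HodgeConjecture.HodgeCM.Automorphic.ThetaFacts

set_option autoImplicit false

/-!
# A9 / A10 through the 2001 discharge packages (typed node targets for PerL v5 Lemma 4.2(b) and Lemma 4.1(c))

The facts `ThetaModel.Open_chars` (A9 = PerL Lemma 4.2(b), hypothesis `H_chars` of Thm 3.7) and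
`ThetaModel.Open_occ` (A10 = PerL Lemma 4.1(c), hypothesis `H_occ`) are stated in `ThetaFacts` in the coarse shape
the isolation theorem consumes.  The vendored 2001 file `HodgeCM.Prior.Perl34File` already contains the PRINT-LEVEL
carving of both lemmas, machine-checked:

* `Perl34.C4.RallisDatum` / `Perl34.C4.CharsDischarge D V` — the Rallis inner-product chain of Lemma 4.2(b)
  (tex ll. 548–632): fields = the Rallis inner product formula in Weil's convergent range (AX7; Li 1992 Thm 2.1,
  Gan–Qiu–Takeda §11.3, Weil 1965), the unramified local values, the ramified positivity (compact-group projection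
  formula), the summability `Σ q_v^{-3/2} < ∞`, the theta vector with `‖θ‖² = ⟨θ,θ⟩`, and the BRIDGE
  `allowed_of_theta : θ ≠ 0 → allowed χ` (Def 3.2's two clauses from non-vanishing: AX3 + AX1b(d), ll. 632–635);
  PROVED there: Euler-factor bounds, positivity of the tail, `innerSelf_pos`, `θvec_ne_zero`, and
  `CharsDischarge.H_chars : ∀ χ, D.allowed χ`.
* `Perl34.C4a.PointedCore` / `Perl34.C4a.OccDischarge D P` — Lemma 4.1(c) (ll. 488–523): point evaluations of
  `C([G_U])` separating functions (M1), `wOccurs_of_Pw` (semantic bridge), `arch_functional` (the modified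
  Fock–Schwartz vector with a `P_w`-averaged nonzero point functional: A#9(i)(ii) + AX3 with the vacuum
  `ν = (0,0,−2)`); PROVED there: `pointFunctional` continuity, sup-norm detection, `OccDischarge.H_occ`.

This file records the two joins, so that a DAG of PerL §4 can target the packages' FIELDS as nodes:
`Open_charsPkg → Open_chars` and `Open_occPkg → Open_occ`.  HONESTY NOTE (costume audit): the finer inputs are
NOT weaker than A9/A10 in logical strength — each package carries a bridge field (`allowed_of_theta`,
`wOccurs_of_Pw` + `arch_functional`) in which the residual content of the lemma sits; what the refinement buys is
bookkeeping: every other field is a print statement with a citation, and the analytic glue is proved.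
-/

namespace HodgeCM

open HodgeCM.Prior.Perl34File

namespace Universe

namespace ThetaModel

variable {U : Universe} (T : U.ThetaModel)

/-- **FINER INPUT for A9 (PerL Lemma 4.2(b) as the 2001 Rallis package).** In a good context, both torus sides
carry a `C4.CharsDischarge` package (for some index type of places): per character `χ` of `[T]` of the side's
archimedean type, a Rallis datum whose inner value is `‖θ_{φ(χ)}(χ)‖²`, and the bridge "`θ ≠ 0 ⇒ χ` arises
from an allowed pair".  Joins to `Open_chars` by `C4.CharsDischarge.H_chars` (`chars_of_charsPkg`). -/
def Open_charsPkg : Prop :=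
  ∀ {L : CMField} {ι₁ : L →+* ℂ} (V : HermSpace3 L ι₁) (c : SeesawCtx L), T.GoodCtx ι₁ c →
    (∃ W : Type, Nonempty (Perl34.C4.CharsDischarge (T.t12 V c) W)) ∧
      (∃ W : Type, Nonempty (Perl34.C4.CharsDischarge (T.t34 V c) W))

/-- **FINER INPUT for A10 (PerL Lemma 4.1(c) as the 2001 occurrence package).** In a good context, the core
carries point evaluations (`C4a.PointedCore`) and both torus sides an `C4a.OccDischarge` package over it.  Joins
to `Open_occ` by `C4a.OccDischarge.H_occ` (`occ_of_occPkg`). -/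
def Open_occPkg : Prop :=
  ∀ {L : CMField} {ι₁ : L →+* ℂ} (V : HermSpace3 L ι₁) (c : SeesawCtx L), T.GoodCtx ι₁ c →
    ∃ P : Perl34.C4a.PointedCore (T.core V c),
      Nonempty (Perl34.C4a.OccDischarge (T.t12 V c) P) ∧ Nonempty (Perl34.C4a.OccDischarge (T.t34 V c) P)

/-- **Join A9**: the Rallis packages give `H_chars` on both sides (PerL ll. 398–400, 441–442). -/
theorem chars_of_charsPkg (h : T.Open_charsPkg) : T.Open_chars := by
  intro L ι₁ V c hc
  obtain ⟨⟨W₁, ⟨P₁⟩⟩, ⟨W₂, ⟨P₂⟩⟩⟩ := h V c hc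
  exact ⟨P₁.H_chars, P₂.H_chars⟩

/-- **Join A10**: the occurrence packages give `H_occ` on both sides (PerL ll. 442–443). -/
theorem occ_of_occPkg (h : T.Open_occPkg) : T.Open_occ := by
  intro L ι₁ V c hc
  obtain ⟨P, ⟨O₁⟩, ⟨O₂⟩⟩ := h V c hc
  exact ⟨fun Φ i hΦ => O₁.H_occ Φ i hΦ, fun Φ i hΦ => O₂.H_occ Φ i hΦ⟩

/-- The isolation setting of a good context assembled by the 2001 capstone `C4a.mkIsolationSetting` agrees with
the one `RealisationConstruction` builds from `Open_chars` / `Open_occ`: same core and torus sides (by `rfl`). -/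
theorem mkIsolationSetting_core {L : CMField} {ι₁ : L →+* ℂ} (V : HermSpace3 L ι₁) (c : SeesawCtx L)
    {W₁ W₂ : Type} (P : Perl34.C4a.PointedCore (T.core V c))
    (chA : Perl34.C4.CharsDischarge (T.t12 V c) W₁) (chB : Perl34.C4.CharsDischarge (T.t34 V c) W₂)
    (ocA : Perl34.C4a.OccDischarge (T.t12 V c) P) (ocB : Perl34.C4a.OccDischarge (T.t34 V c) P) :
    (Perl34.C4a.mkIsolationSetting (T.core V c) (T.t12 V c) (T.t34 V c) P chA chB ocA ocB).core = T.core V c ∧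
      (Perl34.C4a.mkIsolationSetting (T.core V c) (T.t12 V c) (T.t34 V c) P chA chB ocA ocB).t12 = T.t12 V c ∧
      (Perl34.C4a.mkIsolationSetting (T.core V c) (T.t12 V c) (T.t34 V c) P chA chB ocA ocB).t34 = T.t34 V c :=
  ⟨rfl, rfl, rfl⟩

/-- `ThetaModel.Inputs` from the two print facts, the two design constraints, the four other open inputs and the
two FINER package inputs.  (Packager, run 18: the seat's v5 stated this for its two-record split
`ModelFacts`/`OpenInputs`; the landed package keeps ONE partitioned record `ThetaModel.Inputs`, so the binder list is
the v4 one, `h₁ … h₁₀` — a mechanical adaptation, no mathematical content.) -/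
theorem Inputs.of_pkg (h₁ : T.Fact_embCover) (h₂ : T.Fact_innerEmb) (h₃ : T.Design_kappaConj)
    (h₄ : T.Design_frameSignConj) (h₅ : T.Open_thetaSub) (h₆ : T.Open_thetaWedge) (h₇ : T.Open_thetaGen12)
    (h₈ : T.Open_thetaReal34) (h₉ : T.Open_charsPkg) (h₁₀ : T.Open_occPkg) : T.Inputs :=
  ⟨h₁, h₂, h₃, h₄, h₅, h₆, h₇, h₈, T.chars_of_charsPkg h₉, T.occ_of_occPkg h₁₀⟩

end ThetaModel

end Universe

end HodgeCM
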